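import Summits.QuantumFields.YangMills.Theorems.LuscherReductionTwistedTraceScalingBOStiffCentralLower
import Summits.QuantumFields.YangMills.Theorems.LuscherReductionTwistedTraceScalingBOStiffKinDefectLower
import Summits.QuantumFields.YangMills.Theorems.LuscherReductionTwistedTraceScalingBOStiffTransportTail
import Summits.QuantumFields.YangMills.Theorems.LuscherReductionTwistedTraceScalingBOStiffNearProduct
import HarnessLib

/-!
# (B-ST) atom (B4b), part 1: THE POINTWISE UPPER TWIN — the based central kernel is bounded ABOVE by the same flat Gaussian plus a superpolynomially small tail
# (lane A of S-BASE, crux `TwistedTraceScaling` stmt-QuantumFields-20203, C4-CORE, the (B-ST) pen; `pub/ym-fleet/ym-luscher-20007-p1/HANDOFF-g22.md` §DESIGN 4, cdisprove UPDATE 24 (d))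

The currency of the jump floor `hJ` (`cJ·cΛ·J₀ ≤ cΘ·cM·cΘ` with β-free `cJ`) needs `cΛ = ⟨Θ,MΘ⟩/∫Θ²w` bounded above AT THE SCALE of ✓`…BOStiffCentralLower.cM_lower`, i.e. the
Θ-integrated pointwise upper twin of the lower bound (cdisprove U24 (d): no cruder sup bound will do).  THIS FILE is the pointwise half:
Inputs from ✓`…BOStiffKinDefectLower`: `kinDefect ≥ ‖x̂ − x̂' + ∇flatLin w‖² − 136|E|τ³`, the based T-core in the chart (flat sup norm `≤ 2T`).
* §1 ★★★ `cM_le_flat_gaussian` (fixed `β`): T-core split — off the core ✓`…BOStiffTransportTail.integral_basedKernel_off_core_le` (`≤ e^{2β|E|}e^{−β(T/(6L)−b)²}`), on the core the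
  upper Haar sandwich ✓`integral_pi_haar_le_flat`, the reversed defect bound, Pythagoras at the centre `w₁` (`x̂−x̂'+∇flatLin w₁ = v ⊥ Γ`), translation and the EXACT flat
  Gaussian ✓`laplaceIntegral_eq`:  `cM ≤ e^{β2|E|−(β/2)(S+S')}·(2π²)^{-n}·e^{136β|E|τ³}·e^{−β‖v‖²}·(π/β)^{d/2}/√gramDet0 + e^{2β|E|}e^{−β(T/(6L)−b)²}`;
* §2 ★★★ `cM_upper` — eventually in `β`, for all `x, x' ∈ cS L β`:
  `cM ≤ (1+ε)·((e^{2β})^{|E|}·fpWeightBar L (powScale (1/2) β))·(e^{−(β/2)(S(oT1x)+S(oT1x'))}·e^{−β‖(x̂−x̂')−P_Γ(x̂−x̂')‖²}) + (e^{2β})^{|E|}·e^{−btLog β⁴/(144L²)}`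
  (schedule `T = β^{-1/2}ℓ²`, `a = √2r`, `b = 2√2r`, `τ = (2√3)β^{-1/2}ℓ² ∨ …`; `βτ³ = O(β^{-1/2}ℓ⁶) → 0`).
With ✓`cM_lower` this pins `cM` on `cS × cS` to `(1±ε)·e^{2β|E|}fpWeightBar(β^{-1/2})·e^{−(β/2)(S+S')}e^{−β‖P_⊥(x̂−x̂')‖²}` up to the `e^{−ℓ⁴/(144L²)}`-tail.
HONEST FRAMING: the pointwise half of (B4b) for a stub of a child of the CONDITIONAL route R2b1; the Θ-integration (needs PiDensity) and hflat remain; (B-ST) OPEN; C4-CORE OPEN; not infinite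
volume, not a gap, not Clay.
-/

set_option autoImplicit false

noncomputable section

open MeasureTheory Filter Topology Real
open scoped BigOperators Matrix Quaternion
open Literature.MathematicalPhysics.QuantumFieldTheory
open Literature.MathematicalPhysics.QuantumLattice

namespace Summit.QuantumFields.YangMills.Theorems.FemtoTransferGap.TwoLattice.ConstTube

open Summit.QuantumFields.YangMills.Theorems.FemtoTransferGap
open Summit.QuantumFields.YangMills.Theorems.FemtoTransferGap.TwoLattice
open Summit.QuantumFields.YangMills.Theorems.FemtoTransferGap.TwoLattice.Avg
open Summit.QuantumFields.YangMills.Theorems.FemtoTransferGap.TwoLattice.Stiff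
open Summit.QuantumFields.YangMills.Theorems.FemtoTransferGap.TwoLattice.GnChart
open Summit.QuantumFields.YangMills.Theorems.FemtoTransferGap.TwoLattice.Cov (scalarPart_inv vecPart_inv)
open Literature.MathematicalPhysics.QuantumFieldTheory.Balaban1983to89.T4CubeChartGnomonic (gnoPoint)

variable {L : ℕ} [NeZero L]

/-! ## §1 ★★★ The upper bound at fixed `β` -/

set_option maxHeartbeats 1600000 in
-- long chain of integral comparisons.
/-- ★★★ **THE BASED CENTRAL KERNEL IS BOUNDED ABOVE BY THE FLAT GAUSSIAN PLUS THE OFF-CORE TAIL** (see the module docstring). [cite: Luscher1983, §3] [cite: SjostrandZworski2007, §2] -/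
theorem cM_le_flat_gaussian (hL : Nonempty (NzSite L)) {β : ℝ} (hβ : 0 < β) {x x' : Edge 3 L → Fin 3 → ℝ}
    (hx : ∀ e, ∑ a, x e a ^ 2 ≤ 1) (hx' : ∀ e, ∑ a, x' e a ^ 2 ≤ 1) (w₁ : NzSite L → Fin 3 → ℝ) {v : LinkSpace L} (hv : v ∈ (gaugeModes L)ᗮ)
    (hw₁ : linkEmbed L (x - x') + vacGrad L (flatLin L w₁ : Site 3 L → Fin 3 → ℝ) = v) {τ T a b : ℝ} (hT0 : 0 ≤ T) (hT1 : T ≤ 1) (hτ1 : τ ≤ 1)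
    (hτx : Real.sqrt 2 * ‖linkEmbed L x‖ ≤ τ) (hτx' : Real.sqrt 2 * ‖linkEmbed L x'‖ ≤ τ) (hτT : Real.sqrt 3 * (2 * T) ≤ τ)
    (ha : ∀ e : Edge 3 L, ‖su2Quat (orthoTube L 1 x e) - 1‖ ≤ a) (hb : ∀ e : Edge 3 L, ‖su2Quat (orthoTube L 1 x e) - su2Quat (orthoTube L 1 x' e)‖ ≤ b)
    (hLa : 12 * L * a ≤ 1) (hTb : b ≤ T / (6 * L)) :
    cM L β x x' ≤
      Real.exp (β * (2 * (Fintype.card (Edge 3 L) : ℝ)) - β / 2 * (wilsonAction su2Rep (orthoTube L 1 x) + wilsonAction su2Rep (orthoTube L 1 x'))) *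
          (((2 * π ^ 2)⁻¹) ^ Fintype.card (NzSite L) *
            (Real.exp (β * (136 * Fintype.card (Edge 3 L) * τ ^ 3)) * Real.exp (-(β * ‖v‖ ^ 2)) * ((π * β⁻¹) ^ (flatDim L / 2 : ℝ) / Real.sqrt (gramDet L 0)))) +
        Real.exp (β * (2 * (Fintype.card (Edge 3 L) : ℝ))) * Real.exp (-(β * (T / (6 * L) - b) ^ 2)) := by
  classical
  set U := orthoTube L 1 x with hU
  set V := orthoTube L 1 x' with hV
  set nE : ℝ := (Fintype.card (Edge 3 L) : ℝ) with hnE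
  set n : ℕ := Fintype.card (NzSite L) with hn
  set Cmag := Real.exp (β * (2 * nE) - β / 2 * (wilsonAction su2Rep U + wilsonAction su2Rep V)) with hCmag
  have hCmag0 : 0 < Cmag := Real.exp_pos _
  have hτ0 : 0 ≤ τ := le_trans (by positivity) hτx
  -- the integrand and the core
  set F : (NzSite L → SU2) → ℝ := fun h => transferKernel su2Rep β U (gaugeTransform (basedExt L h) V) with hFdef
  have hF : ∀ h, F h = Cmag * Real.exp (-(β * kinDefect L U V (basedExt L h))) := fun h => transferKernel_basedExt_eq β U V h
  have hFm : Measurable F := measurable_transferKernel_basedExt β U V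
  have hF0 : ∀ h, 0 ≤ F h := fun h => by rw [hF h]; positivity
  have hFle : ∀ h, F h ≤ Cmag := fun h => by
    rw [hF h]
    have : Real.exp (-(β * kinDefect L U V (basedExt L h))) ≤ 1 := Real.exp_le_one_iff.2 (by have := kinDefect_nonneg (L := L) U V (basedExt L h); nlinarith)
    nlinarith
  set core : Set (NzSite L → SU2) := {h | ∀ y, ‖su2Quat (h y) - 1‖ ≤ T} with hcore
  have hcm : MeasurableSet core := measurableSet_basedCore T
  haveI : IsProbabilityMeasure (basedMeasure L) := by unfold basedMeasure; infer_instance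
  have hFint : Integrable F (basedMeasure L) :=
    integrable_of_measurable_abs_le (basedMeasure L) hFm (C := Cmag) fun h => by rw [abs_of_nonneg (hF0 h)]; exact hFle h
  -- split
  have hsplit : cM L β x x' = (∫ h, core.indicator F h ∂basedMeasure L) + ∫ h, coreᶜ.indicator F h ∂basedMeasure L := by
    have : cM L β x x' = ∫ h, F h ∂basedMeasure L := rfl
    rw [this, ← integral_add (hFint.indicator hcm) (hFint.indicator hcm.compl)]
    exact integral_congr_ae (ae_of_all _ fun h => (congrFun (Set.indicator_self_add_compl core F) h).symm)
  -- the tail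
  have htail : ∫ h, coreᶜ.indicator F h ∂basedMeasure L ≤ Real.exp (β * (2 * nE)) * Real.exp (-(β * (T / (6 * L) - b) ^ 2)) :=
    integral_basedKernel_off_core_le (L := L) hβ.le U V ha hb hLa hTb
  -- the core part through the chart
  set g : (NzSite L → SU2) → ℝ := core.indicator F with hg
  have hgm : Measurable g := hFm.indicator hcm
  have hg0 : ∀ h, 0 ≤ g h := fun h => Set.indicator_nonneg (fun h _ => hF0 h) h
  have hgF : ∀ h, g h ≤ F h := fun h => Set.indicator_le_self' (fun h _ => hF0 h) h
  have hgb : ∃ C : ℝ, ∀ h, |g h| ≤ C := ⟨Cmag, fun h => by rw [abs_of_nonneg (hg0 h)]; exact (hgF h).trans (hFle h)⟩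
  have hg00 : ∀ W : NzSite L → SU2, (∃ i, scalarPart (W i) ≤ 0) → g W = 0 := fun W ⟨i, hi⟩ => by
    rw [hg, Set.indicator_of_notMem]; intro hW; exact absurd (scalarPart_pos_of_core hT1 hW i) (not_lt.2 hi)
  -- flat data
  set A := laplaceMap L 0 with hA
  set s : ℝ := (Real.sqrt β)⁻¹ with hs
  have hs0 : 0 < s := by positivity
  have hs2 : s ^ 2 = β⁻¹ := by rw [hs, inv_pow, Real.sq_sqrt hβ.le]
  have hQ : ∀ w : NzSite L → Fin 3 → ℝ, 1 * ‖A w‖ ^ 2 / s ^ 2 = β * ‖vacGrad L (flatLin L w : Site 3 L → Fin 3 → ℝ)‖ ^ 2 := fun w => by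
    rw [hs2, hA, norm_laplaceMap_zero]; field_simp
  have hc : 0 < (2 * sliceConst L)⁻¹ := by have := sliceConst_pos L; positivity
  have hcoer : ∀ w, (2 * sliceConst L)⁻¹ * ‖w‖ ≤ ‖A w‖ := fun w => by rw [hA]; exact norm_le_laplaceMap_zero w
  set C₂ := Cmag * (Real.exp (β * (136 * nE * τ ^ 3)) * Real.exp (-(β * ‖v‖ ^ 2))) with hC₂
  have hC₂0 : 0 < C₂ := by positivity
  set G₂ : (NzSite L → Fin 3 → ℝ) → ℝ := fun w => C₂ * Real.exp (-(1 * ‖A (w - w₁)‖ ^ 2 / s ^ 2)) with hG₂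
  have hG₂int : Integrable G₂ := by
    have h1 : Integrable (fun w : NzSite L → Fin 3 → ℝ => Real.exp (-(1 * ‖A w‖ ^ 2 / s ^ 2))) := integrable_exp_neg_quad A hc hs0 one_pos hcoer
    exact (h1.comp_sub_right w₁).const_mul C₂
  -- pointwise domination of the chart pull-back
  have hdom : ∀ w : NzSite L → Fin 3 → ℝ, g (piPatternChart (NzSite L) (fun _ => false) w) ≤ G₂ w := by
    intro w
    have hpc : piPatternChart (NzSite L) (fun _ => false) w = fun y => gnoPoint (w y) := funext fun y => piPatternChart_false _ w y
    rw [hpc]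
    by_cases hw : (fun y => gnoPoint (w y)) ∈ core
    · rw [hg, Set.indicator_of_mem hw, hF]
      have hwT : ‖w‖ ≤ 2 * T := norm_le_of_gno_core hT0 hT1 hw
      have hτw : Real.sqrt 3 * ‖w‖ ≤ τ := le_trans (mul_le_mul_of_nonneg_left hwT (Real.sqrt_nonneg 3)) hτT
      have hkd := kinDefect_central_based_ge (L := L) hx hx' w hτ1 hτx hτx' hτw
      have hsplit' : linkEmbed L (x - x') + vacGrad L (flatLin L w : Site 3 L → Fin 3 → ℝ) = v + vacGrad L (flatLin L (w - w₁) : Site 3 L → Fin 3 → ℝ) := by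
        rw [← hw₁, (flatLin L).map_sub, Submodule.coe_sub, (vacGrad L).map_sub]; abel
      rw [hsplit', norm_sq_split hv] at hkd
      simp only [hG₂]
      rw [hQ (w - w₁), hC₂]
      have hexp : Real.exp (-(β * kinDefect L U V (basedExt L fun y => gnoPoint (w y)))) ≤
          Real.exp (β * (136 * nE * τ ^ 3)) * Real.exp (-(β * ‖v‖ ^ 2)) * Real.exp (-(β * ‖vacGrad L (flatLin L (w - w₁) : Site 3 L → Fin 3 → ℝ)‖ ^ 2)) := by
        rw [← Real.exp_add, ← Real.exp_add]
        refine Real.exp_le_exp.2 ?_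
        have := mul_le_mul_of_nonneg_left hkd hβ.le
        rw [hnE]; nlinarith
      calc Cmag * Real.exp (-(β * kinDefect L U V (basedExt L fun y => gnoPoint (w y))))
          ≤ Cmag * (Real.exp (β * (136 * nE * τ ^ 3)) * Real.exp (-(β * ‖v‖ ^ 2)) * Real.exp (-(β * ‖vacGrad L (flatLin L (w - w₁) : Site 3 L → Fin 3 → ℝ)‖ ^ 2))) :=
            mul_le_mul_of_nonneg_left hexp hCmag0.le
        _ = Cmag * (Real.exp (β * (136 * nE * τ ^ 3)) * Real.exp (-(β * ‖v‖ ^ 2))) * Real.exp (-(β * ‖vacGrad L (flatLin L (w - w₁) : Site 3 L → Fin 3 → ℝ)‖ ^ 2)) := by ring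
    · rw [hg, Set.indicator_of_notMem hw, hG₂]; positivity
  have hGm : Measurable fun w : NzSite L → Fin 3 → ℝ => g (piPatternChart (NzSite L) (fun _ => false) w) := measurable_comp_vacuumChart (NzSite L) hgm
  have hint : Integrable fun w : NzSite L → Fin 3 → ℝ => g (piPatternChart (NzSite L) (fun _ => false) w) :=
    hG₂int.mono' hGm.aestronglyMeasurable (ae_of_all _ fun w => by rw [Real.norm_eq_abs, abs_of_nonneg (hg0 _)]; exact hdom w)
  -- upper Haar sandwich and the flat Gaussian
  have h2 := integral_pi_haar_le_flat (ι := NzSite L) hgm hgb hg0 hg00 hint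
  have h3 : ∫ w, g (piPatternChart (NzSite L) (fun _ => false) w) ∂(volume : Measure (NzSite L → Fin 3 → ℝ)) ≤ ∫ w, G₂ w ∂volume :=
    integral_mono hint hG₂int hdom
  have hI1 : ∫ w, Real.exp (-(1 * ‖A w‖ ^ 2 / s ^ 2)) ∂(volume : Measure (NzSite L → Fin 3 → ℝ)) = (π * β⁻¹) ^ (flatDim L / 2 : ℝ) / Real.sqrt (gramDet L 0) := by
    have h := (laplaceIntegral_eq L).self_of_nhds (a := 1) one_pos hs0
    rw [hA, h, hs2, div_one]
  have h4 : ∫ w, G₂ w ∂(volume : Measure (NzSite L → Fin 3 → ℝ)) = C₂ * ((π * β⁻¹) ^ (flatDim L / 2 : ℝ) / Real.sqrt (gramDet L 0)) := by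
    rw [hG₂, integral_const_mul, integral_sub_right_eq_self (fun w => Real.exp (-(1 * ‖A w‖ ^ 2 / s ^ 2))) w₁, hI1]
  -- assemble
  have hcorepart : ∫ h, core.indicator F h ∂basedMeasure L ≤ ((2 * π ^ 2)⁻¹) ^ n * (C₂ * ((π * β⁻¹) ^ (flatDim L / 2 : ℝ) / Real.sqrt (gramDet L 0))) := by
    have hpos : (0 : ℝ) ≤ ((2 * π ^ 2)⁻¹) ^ n := by positivity
    calc ∫ h, core.indicator F h ∂basedMeasure L = ∫ h, g h ∂basedMeasure L := rfl
      _ ≤ ((2 * π ^ 2)⁻¹) ^ n * ∫ w, g (piPatternChart (NzSite L) (fun _ => false) w) ∂volume := h2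
      _ ≤ ((2 * π ^ 2)⁻¹) ^ n * ∫ w, G₂ w ∂volume := mul_le_mul_of_nonneg_left h3 hpos
      _ = _ := by rw [h4]
  rw [hsplit]
  calc (∫ h, core.indicator F h ∂basedMeasure L) + ∫ h, coreᶜ.indicator F h ∂basedMeasure L
      ≤ ((2 * π ^ 2)⁻¹) ^ n * (C₂ * ((π * β⁻¹) ^ (flatDim L / 2 : ℝ) / Real.sqrt (gramDet L 0))) + Real.exp (β * (2 * nE)) * Real.exp (-(β * (T / (6 * L) - b) ^ 2)) :=
        add_le_add hcorepart htail
    _ = _ := by rw [hC₂]; ring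

/-! ## §2 ★★★ The upper bound on the profile support, eventually in `β` -/

set_option maxHeartbeats 1600000 in
-- long record expressions.
/-- ★★★ **THE POINTWISE UPPER TWIN OF `cM_lower`** (see the module docstring). [cite: Luscher1983, §3] [cite: SjostrandZworski2007, §2] -/
theorem cM_upper (hL : Nonempty (NzSite L)) {ε : ℝ} (hε : 0 < ε) :
    ∀ᶠ β : ℝ in atTop, ∀ x ∈ cS L β, ∀ x' ∈ cS L β,
      cM L β x x' ≤
        (1 + ε) * ((Real.exp (2 * β) ^ Fintype.card (Edge 3 L) * fpWeightBar L (powScale (1 / 2) β)) *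
            (Real.exp (-(β / 2 * (wilsonAction su2Rep (orthoTube L 1 x) + wilsonAction su2Rep (orthoTube L 1 x')))) *
              Real.exp (-(β * ‖(linkEmbed L (x - x')) - (gaugeModes L).starProjection (linkEmbed L (x - x'))‖ ^ 2)))) +
          Real.exp (2 * β) ^ Fintype.card (Edge 3 L) * Real.exp (-(btLog β ^ 4 / (144 * (L : ℝ) ^ 2))) := by
  -- constants and schedule
  set CL := sliceConst L with hCL
  have hCL0 : 0 < CL := sliceConst_pos L
  set nE : ℝ := (Fintype.card (Edge 3 L) : ℝ) with hnE
  set d2 : ℝ := (flatDim L / 2 : ℝ) with hd2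
  set r : ℝ → ℝ := fun β => min (1 / 40) (powScale (1 / 2) β * btLog β) with hr
  set T : ℝ → ℝ := fun β => powScale (1 / 2) β * btLog β ^ 2 with hT
  have hr0 : ∀ β, 0 < r β := fun β => lt_min (by norm_num) (mul_pos (powScale_pos _ _) (lt_of_lt_of_le one_pos (one_le_btLog β)))
  have hT0 : ∀ β, 0 < T β := fun β => mul_pos (powScale_pos _ _) (pow_pos (lt_of_lt_of_le one_pos (one_le_btLog β)) 2)
  have hL1 : (1 : ℝ) ≤ L := by exact_mod_cast Nat.one_le_iff_ne_zero.2 (NeZero.ne L)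
  set K : ℝ := Real.sqrt 2 + 2 * Real.sqrt 3 with hK
  have hK0 : 0 < K := by positivity
  -- r ≤ T (since btLog ≥ 1), both → 0
  have hrT : ∀ β, r β ≤ T β := fun β => by
    have hl := one_le_btLog β
    have hl2 : btLog β ≤ btLog β ^ 2 := by nlinarith
    calc r β ≤ powScale (1 / 2) β * btLog β := min_le_right _ _
      _ ≤ powScale (1 / 2) β * btLog β ^ 2 := mul_le_mul_of_nonneg_left hl2 (powScale_pos (1 / 2) β).le
  have hTt : Tendsto T atTop (𝓝 0) := tendsto_powScale_mul_btLog_pow (p := 1 / 2) (by norm_num) 2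
  have h6 : Tendsto (fun β : ℝ => powScale (1 / 2) β * btLog β ^ 6) atTop (𝓝 0) := tendsto_powScale_mul_btLog_pow (p := 1 / 2) (by norm_num) 6
  -- β (K T)³ = K³ β pS³ ℓ⁶ = K³ pS ℓ⁶ for β ≥ 1
  have hβT3 : Tendsto (fun β : ℝ => β * (136 * nE * (K * T β) ^ 3)) atTop (𝓝 0) := by
    have h := h6.const_mul (136 * nE * K ^ 3)
    rw [mul_zero] at h
    refine h.congr' ?_
    filter_upwards [eventually_ge_atTop (1 : ℝ)] with β hβ
    have hp := powScale_half_sq hβ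
    have e : β * (136 * nE * (K * T β) ^ 3) = 136 * nE * K ^ 3 * ((β * powScale (1 / 2) β ^ 2) * (powScale (1 / 2) β * btLog β ^ 6)) := by
      simp only [hT]; ring
    rw [e, hp, mul_inv_cancel₀ (by linarith), one_mul]
  have hcorr : Tendsto (fun β : ℝ => Real.exp (β * (136 * nE * (K * T β) ^ 3))) atTop (𝓝 1) := by
    have h2 := (Real.continuous_exp.tendsto 0).comp hβT3
    rw [Real.exp_zero] at h2; exact h2
  have hev_corr : ∀ᶠ β : ℝ in atTop, Real.exp (β * (136 * nE * (K * T β) ^ 3)) < 1 + ε := (tendsto_order.1 hcorr).2 (1 + ε) (by linarith)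
  have hev_T1 : ∀ᶠ β : ℝ in atTop, K * T β ≤ 1 := by
    have h := (hTt.const_mul K).eventually (eventually_le_nhds (show K * 0 < 1 by simp))
    exact h
  have hev_La : ∀ᶠ β : ℝ in atTop, 12 * L * (Real.sqrt 2 * T β) ≤ 1 := by
    have h := (hTt.const_mul (12 * L * Real.sqrt 2)).eventually (eventually_le_nhds (show 12 * L * Real.sqrt 2 * 0 < 1 by simp))
    filter_upwards [h] with β hβ; linarith [hβ]
  have hev_b : ∀ᶠ β : ℝ in atTop, 24 * Real.sqrt 2 * L * r β ≤ T β := by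
    have hl : ∀ᶠ β : ℝ in atTop, 24 * Real.sqrt 2 * L ≤ btLog β := tendsto_btLog_atTop.eventually (eventually_ge_atTop _)
    filter_upwards [hl] with β hβ
    have hps := powScale_pos (1 / 2) β
    have hl1 := one_le_btLog β
    calc 24 * Real.sqrt 2 * L * r β ≤ 24 * Real.sqrt 2 * L * (powScale (1 / 2) β * btLog β) := by
          have := min_le_right (1 / 40 : ℝ) (powScale (1 / 2) β * btLog β); have h0 : (0:ℝ) ≤ 24 * Real.sqrt 2 * L := by positivity
          exact mul_le_mul_of_nonneg_left this h0
      _ = (24 * Real.sqrt 2 * L) * btLog β * powScale (1 / 2) β := by ring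
      _ ≤ btLog β * btLog β * powScale (1 / 2) β := by
          have : (24 * Real.sqrt 2 * L) * btLog β ≤ btLog β * btLog β := mul_le_mul_of_nonneg_right hβ (by linarith)
          exact mul_le_mul_of_nonneg_right this hps.le
      _ = T β := by simp only [hT]; ring
  filter_upwards [hev_corr, hev_T1, hev_La, hev_b, eventually_ge_atTop (1 : ℝ)] with β hcorrβ hT1β hLaβ hbβ hβ1 x hx x' hx'
  have hβ0 : 0 < β := by linarith
  -- geometry of the two points
  obtain ⟨-, hxr⟩ := cΘ_eq_on_cS (L := L) β hx
  obtain ⟨-, hxr'⟩ := cΘ_eq_on_cS (L := L) β hx'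
  have hx1 : ∀ e, ∑ a, x e a ^ 2 ≤ 1 := sum_sq_le_one_of_mem_cS hx
  have hx1' : ∀ e, ∑ a, x' e a ^ 2 ≤ 1 := sum_sq_le_one_of_mem_cS hx'
  change ‖linkEmbed L x‖ ≤ r β at hxr
  change ‖linkEmbed L x'‖ ≤ r β at hxr'
  set Δ := linkEmbed L (x - x') with hΔ
  obtain ⟨w₁, hw₁g, -⟩ := exists_flat_centre (L := L) Δ
  set v := Δ - (gaugeModes L).starProjection Δ with hv
  have hvmem : v ∈ (gaugeModes L)ᗮ := Submodule.sub_starProjection_mem_orthogonal Δ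
  have hw₁v : linkEmbed L (x - x') + vacGrad L (flatLin L w₁ : Site 3 L → Fin 3 → ℝ) = v := by rw [hw₁g, ← hΔ, hv, sub_eq_add_neg]
  -- schedule at this β
  have hrβ := hr0 β
  have hTβ := hT0 β
  have hrTβ := hrT β
  set τ := K * T β with hτ
  have hT1' : T β ≤ 1 := by
    have : T β ≤ K * T β := by
      have hK1 : 1 ≤ K := by
        have h2 : 1 ≤ Real.sqrt 2 := by rw [show (1:ℝ) = Real.sqrt 1 from (Real.sqrt_one).symm]; exact Real.sqrt_le_sqrt (by norm_num)
        have h3 : 0 ≤ Real.sqrt 3 := Real.sqrt_nonneg 3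
        linarith
      nlinarith
    exact this.trans hT1β
  have hτx : Real.sqrt 2 * ‖linkEmbed L x‖ ≤ τ := by
    have h1 : Real.sqrt 2 * ‖linkEmbed L x‖ ≤ Real.sqrt 2 * T β := mul_le_mul_of_nonneg_left (hxr.trans hrTβ) (Real.sqrt_nonneg 2)
    have e : τ = Real.sqrt 2 * T β + 2 * Real.sqrt 3 * T β := by rw [hτ, hK]; ring
    have : 0 ≤ 2 * Real.sqrt 3 * T β := by positivity
    rw [e]; linarith
  have hτx' : Real.sqrt 2 * ‖linkEmbed L x'‖ ≤ τ := by
    have h1 : Real.sqrt 2 * ‖linkEmbed L x'‖ ≤ Real.sqrt 2 * T β := mul_le_mul_of_nonneg_left (hxr'.trans hrTβ) (Real.sqrt_nonneg 2)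
    have e : τ = Real.sqrt 2 * T β + 2 * Real.sqrt 3 * T β := by rw [hτ, hK]; ring
    have : 0 ≤ 2 * Real.sqrt 3 * T β := by positivity
    rw [e]; linarith
  have hτT : Real.sqrt 3 * (2 * T β) ≤ τ := by
    have e : τ = Real.sqrt 2 * T β + 2 * Real.sqrt 3 * T β := by rw [hτ, hK]; ring
    have : 0 ≤ Real.sqrt 2 * T β := by positivity
    rw [e]; linarith
  -- the kinetic data of the central pair
  have ha : ∀ e : Edge 3 L, ‖su2Quat (orthoTube L 1 x e) - 1‖ ≤ Real.sqrt 2 * T β := fun e =>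
    (norm_su2Quat_orthoTube_one_sub_one_le hx1 e).trans (mul_le_mul_of_nonneg_left (hxr.trans hrTβ) (Real.sqrt_nonneg 2))
  have hb : ∀ e : Edge 3 L, ‖su2Quat (orthoTube L 1 x e) - su2Quat (orthoTube L 1 x' e)‖ ≤ 2 * Real.sqrt 2 * r β := fun e => by
    have h1 := norm_su2Quat_orthoTube_one_sub_one_le hx1 e
    have h2 := norm_su2Quat_orthoTube_one_sub_one_le hx1' e
    calc ‖su2Quat (orthoTube L 1 x e) - su2Quat (orthoTube L 1 x' e)‖
        = ‖(su2Quat (orthoTube L 1 x e) - 1) - (su2Quat (orthoTube L 1 x' e) - 1)‖ := by rw [sub_sub_sub_cancel_right]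
      _ ≤ ‖su2Quat (orthoTube L 1 x e) - 1‖ + ‖su2Quat (orthoTube L 1 x' e) - 1‖ := norm_sub_le _ _
      _ ≤ Real.sqrt 2 * r β + Real.sqrt 2 * r β := add_le_add (h1.trans (mul_le_mul_of_nonneg_left hxr (Real.sqrt_nonneg 2)))
          (h2.trans (mul_le_mul_of_nonneg_left hxr' (Real.sqrt_nonneg 2)))
      _ = 2 * Real.sqrt 2 * r β := by ring
  have hL0 : (0 : ℝ) < L := by linarith
  have hTb : 2 * Real.sqrt 2 * r β ≤ T β / (6 * L) := by
    rw [le_div_iff₀ (by positivity)]; nlinarith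
  have hmain := cM_le_flat_gaussian (L := L) hL hβ0 hx1 hx1' w₁ hvmem hw₁v hTβ.le hT1' hT1β hτx hτx' hτT ha hb hLaβ hTb
  -- rewrite the constant and compare the tail
  have hps : powScale (1 / 2) β ^ 2 = β⁻¹ := powScale_half_sq hβ1
  have hfp : fpWeightBar L (powScale (1 / 2) β) = ((2 * π ^ 2)⁻¹) ^ Fintype.card (NzSite L) * (π * β⁻¹) ^ d2 / Real.sqrt (gramDet L 0) := by
    unfold fpWeightBar; rw [hps]
  have hCmag : Real.exp (β * (2 * (Fintype.card (Edge 3 L) : ℝ)) - β / 2 * (wilsonAction su2Rep (orthoTube L 1 x) + wilsonAction su2Rep (orthoTube L 1 x'))) =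
      Real.exp (2 * β) ^ Fintype.card (Edge 3 L) * Real.exp (-(β / 2 * (wilsonAction su2Rep (orthoTube L 1 x) + wilsonAction su2Rep (orthoTube L 1 x')))) := by
    rw [sub_eq_add_neg, Real.exp_add, ← Real.exp_nat_mul]; congr 2; ring
  have hE : Real.exp (β * (2 * (Fintype.card (Edge 3 L) : ℝ))) = Real.exp (2 * β) ^ Fintype.card (Edge 3 L) := by
    rw [← Real.exp_nat_mul]; congr 1; ring
  have htail : Real.exp (-(β * (T β / (6 * L) - 2 * Real.sqrt 2 * r β) ^ 2)) ≤ Real.exp (-(btLog β ^ 4 / (144 * (L : ℝ) ^ 2))) := by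
    refine Real.exp_le_exp.2 (neg_le_neg ?_)
    have h12 : T β / (12 * L) ≤ T β / (6 * L) - 2 * Real.sqrt 2 * r β := by
      have : 2 * Real.sqrt 2 * r β ≤ T β / (12 * L) := by rw [le_div_iff₀ (by positivity)]; nlinarith
      have e : T β / (6 * L) = T β / (12 * L) + T β / (12 * L) := by field_simp; ring
      rw [e]; linarith
    have h12' : 0 ≤ T β / (12 * L) := by positivity
    have hsq : (T β / (12 * L)) ^ 2 ≤ (T β / (6 * L) - 2 * Real.sqrt 2 * r β) ^ 2 := pow_le_pow_left₀ h12' h12 2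
    have e2 : btLog β ^ 4 / (144 * (L : ℝ) ^ 2) = β * (T β / (12 * L)) ^ 2 := by
      simp only [hT]; rw [div_pow, mul_pow, ← pow_mul]; norm_num
      rw [show β * (powScale (1 / 2) β ^ 2 * btLog β ^ 4 / (12 * ↑L) ^ 2) = (β * powScale (1 / 2) β ^ 2) * btLog β ^ 4 / (12 * ↑L) ^ 2 by ring, hps,
        mul_inv_cancel₀ (by linarith), one_mul]; ring
    rw [e2]; exact mul_le_mul_of_nonneg_left hsq hβ0.le
  set P := (Real.exp (2 * β) ^ Fintype.card (Edge 3 L) * fpWeightBar L (powScale (1 / 2) β)) *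
      (Real.exp (-(β / 2 * (wilsonAction su2Rep (orthoTube L 1 x) + wilsonAction su2Rep (orthoTube L 1 x')))) *
        Real.exp (-(β * ‖Δ - (gaugeModes L).starProjection Δ‖ ^ 2))) with hP
  have hP0 : 0 ≤ P := by rw [hP]; have := fpWeightBar_pos L (powScale_pos (1 / 2) β); positivity
  have hRHS1 : Real.exp (β * (2 * (Fintype.card (Edge 3 L) : ℝ)) - β / 2 * (wilsonAction su2Rep (orthoTube L 1 x) + wilsonAction su2Rep (orthoTube L 1 x'))) *
        (((2 * π ^ 2)⁻¹) ^ Fintype.card (NzSite L) *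
          (Real.exp (β * (136 * Fintype.card (Edge 3 L) * τ ^ 3)) * Real.exp (-(β * ‖v‖ ^ 2)) * ((π * β⁻¹) ^ (flatDim L / 2 : ℝ) / Real.sqrt (gramDet L 0)))) =
      Real.exp (β * (136 * nE * (K * T β) ^ 3)) * P := by
    rw [hP, hCmag, hfp, ← hd2, hv, hτ, hnE]; ring
  rw [hRHS1, hE] at hmain
  have hE0 : 0 ≤ Real.exp (2 * β) ^ Fintype.card (Edge 3 L) := by positivity
  calc cM L β x x' ≤ Real.exp (β * (136 * nE * (K * T β) ^ 3)) * P + Real.exp (2 * β) ^ Fintype.card (Edge 3 L) * Real.exp (-(β * (T β / (6 * L) - 2 * Real.sqrt 2 * r β) ^ 2)) := hmain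
    _ ≤ (1 + ε) * P + Real.exp (2 * β) ^ Fintype.card (Edge 3 L) * Real.exp (-(btLog β ^ 4 / (144 * (L : ℝ) ^ 2))) :=
        add_le_add (mul_le_mul_of_nonneg_right hcorrβ.le hP0) (mul_le_mul_of_nonneg_left htail hE0)

end Summit.QuantumFields.YangMills.Theorems.FemtoTransferGap.TwoLattice.ConstTube

end
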